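import Literature.Geometry.Symplectic.SteinLevelTransport
import Literature.Geometry.Symplectic.SteinDomainPush
import Literature.Geometry.Symplectic.SteinSublevelContact
import Literature.Geometry.Symplectic.SteinTwoHandlesProofs
import Literature.Topology.FourManifolds.HandleAttachingMapsTransport
import HarnessLib

/-!
# Legendrian attaching data survive the shrinking of a Stein domain; E2 reduces to shrunk domains

Topic `Literature/Geometry/Symplectic`; proofs file of the fact seat of
`Literature.Geometry.Symplectic.Gompf1998_thm13_twoHandles` (**E2**, `SteinTwoHandles.lean`:
2-handles attached to a compact Stein `(W, J, φ)` along Legendrian knots of twisting `-1` give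
a Stein domain).  The printed proofs (Eliashberg 1990; Gompf 1998, Thm. 1.3; Cieliebak–Eliashberg
2012, Ch. 8) attach the standard Stein handle to a *regular sublevel set* `{φ ≤ c}` of a
`J`-convex function on an **open** complex surface, along Legendrian knots in the level
`{φ = c}`; in the tree the base of E2 is an abstract compact Stein domain whose boundary *is* the
maximal level.  This file performs the reduction between the two settings:

* `FlowoutInput.Cover.mfderiv_push_apply_of_boundary` — on vectors tangent to `∂W`, the
  differential of the **push** of a flow-out (`RegularIntervalBoundary.lean` §5; the
  diffeomorphism `W ≅ {φ ≤ max φ - κ}` of `SteinDomainPush.lean`) is the differential of the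
  flow-out map `Fl(·, κ)` (boundary points are pushed exactly to depth `κ`; test against curves
  inside `∂W`);
* `SteinStructure.continuous_twistingLoop` — the twisting loop of a framed Legendrian knot is
  continuous;
* `SteinStructure.exists_sublevel_transport` — **Gray transport to a lower level**: for a
  compact Stein `W` with `∂W ≠ ∅` there are `c < max φ` above the critical values, the Stein
  sublevel domain `W_c = {φ ≤ c}` (`SteinDomainSublevel.lean`) and a diffeomorphism
  `e : W ≅ W_c` (the push along the normalised Liouville flow, `SteinLiouvilleField.lean`) such
  that for every Legendrian knot `K ⊂ ∂W` with framing `ν`: `e ∘ K` is Legendrian in `∂W_c` for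
  the restricted structure, `de(ν)` is a framing of it, and **the twisting number is unchanged**
  (`SteinLevelTransport.lean`: the flow maps levels to levels and `ξ = ker dφ ∩ ker α` to `ξ`,
  scaling `α` by a positive factor; the twisting loops before and after are never antipodal, so
  the straight-line homotopy between them is zero-free and `wind` is constant,
  `wind_eq_of_homotopy`);
* `Gompf1998_thm13_twoHandles_of_sublevel` — **E2 follows from E2 for shrunk Stein domains**:
  it suffices to prove E2 for bases of the form `(W_c, S.sublevel)`, `c < max φ` a level above
  the critical values of a compact Stein `(W, S)` — which sit inside the open complex surface
  `int W` — by transporting the attaching maps along `e`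
  (`HandleAttachingMap.IsMultiAttachment.transport`, `attachingFraming_transport`).

Everything is **proved**; no named fact is introduced and E2 itself is untouched.

## References

* Ya. Eliashberg, *Topological characterization of Stein manifolds of dimension > 2*, Internat.
  J. Math. 1 (1990), 29–46, §2. [Eliashberg1990Stein]
* R. E. Gompf, *Handlebody construction of Stein surfaces*, Ann. of Math. 148 (1998), Thm. 1.3
  and §1. [Gompf1998]
* K. Cieliebak, Ya. Eliashberg, *From Stein to Weinstein and Back*, AMS Colloquium Publ. 59
  (2012), Def. 1.1 ff., §2, Ch. 8. [CieliebakEliashberg2012]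
-/

noncomputable section

open scoped Manifold ContDiff Topology Bundle
open Set Function Bundle Filter Metric

/-! ### The differential of the push on vectors tangent to the boundary -/

namespace Literature.Topology.FourManifolds.FlowoutInput.Cover

open Literature.Geometry.Symplectic Literature.Geometry.Kaehler

variable {W : Type*} [TopologicalSpace W] [T2Space W] [ChartedSpace (EuclideanHalfSpace 4) W]
  [IsManifold (𝓡∂ 4) ∞ W] {D : FlowoutInput 3 W} (Γ : D.Cover)

omit [T2Space W] in
/-- **A curve inside `∂W` through a boundary point with prescribed tangent vector.**  For
`z ∈ ∂W` and `v` tangent to `∂W` (`v 0 = 0` in the chart at `z`), the curve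
`γ s = c⁻¹(c z + s v)` (`c` the extended chart at `z`) is differentiable at `0` with
`dγ(1) = v`, and for `s` near `0` it stays in `∂W` and in any neighbourhood of `z`. [folklore] -/
theorem exists_curve_in_boundary {z : W} (hz : z ∈ (𝓡∂ 4).boundary W)
    {v : EuclideanSpace ℝ (Fin 4)} (hv : v 0 = 0) {U : Set W} (hU : U ∈ 𝓝 z) :
    ∃ γ : ℝ → W, γ 0 = z ∧ MDifferentiableAt 𝓘(ℝ, ℝ) (𝓡∂ 4) γ 0 ∧
      mfderiv 𝓘(ℝ, ℝ) (𝓡∂ 4) γ 0 1 = v ∧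
      ∀ᶠ s in 𝓝 (0 : ℝ), γ s ∈ (𝓡∂ 4).boundary W ∧ γ s ∈ U := by
  set c := extChartAt (𝓡∂ 4) z with hc
  set q₀ := c z with hq₀
  have hq₀0 : q₀ 0 = 0 := extend_apply_zero_of_isBoundaryPoint hz (mem_chart_source _ z)
  set ℓ : ℝ → EuclideanSpace ℝ (Fin 4) := fun s => q₀ + s • v with hℓ
  have hℓI : ∀ s, ℓ s ∈ range (𝓡∂ 4) := fun s => by
    rw [range_modelWithCornersEuclideanHalfSpace]
    show (0 : ℝ) ≤ (q₀ + s • v) 0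
    rw [PiLp.add_apply, PiLp.smul_apply, hq₀0, hv, smul_zero, add_zero]
  have hℓc : Continuous ℓ := continuous_const.add (continuous_id.smul continuous_const)
  have hℓ0 : ℓ 0 = q₀ := by simp [hℓ]
  -- `ℓ s` lies in the chart target for small `s`
  have htgt : ∀ᶠ s in 𝓝 (0 : ℝ), ℓ s ∈ c.target := by
    have h1 : c.target ∈ 𝓝[range (𝓡∂ 4)] q₀ := extChartAt_target_mem_nhdsWithin z
    have h2 : Tendsto ℓ (𝓝 0) (𝓝[range (𝓡∂ 4)] q₀) :=
      tendsto_nhdsWithin_iff.2 ⟨by rw [← hℓ0]; exact hℓc.tendsto 0, Eventually.of_forall hℓI⟩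
    exact h2 h1
  set γ : ℝ → W := fun s => c.symm (ℓ s) with hγ
  have hγ0 : γ 0 = z := by simp [hγ, hℓ0, hq₀, hc]
  -- differentiability and the derivative at `0`
  have hℓd : HasMFDerivAt 𝓘(ℝ, ℝ) 𝓘(ℝ, EuclideanSpace ℝ (Fin 4)) ℓ 0
      (ContinuousLinearMap.toSpanSingleton ℝ v :) := by
    have h1 : HasDerivAt (fun s : ℝ => s • v) ((1 : ℝ) • v) 0 := (hasDerivAt_id 0).smul_const v
    rw [one_smul] at h1
    have h2 := h1.hasFDerivAt.const_add q₀
    exact h2.hasMFDerivAt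
  have hsymm : HasMFDerivWithinAt 𝓘(ℝ, EuclideanSpace ℝ (Fin 4)) (𝓡∂ 4) c.symm (range (𝓡∂ 4)) (ℓ 0)
      (tangentCoordChange (𝓡∂ 4) z z z :) := by
    have h := (mdifferentiableWithinAt_extChartAt_symm (mem_extChartAt_target (I := 𝓡∂ 4) z)).hasMFDerivWithinAt
    rw [mfderivWithin_extChartAt_symm_eq_tangentCoordChange (mem_extChartAt_target (I := 𝓡∂ 4) z),
      show c.symm (c z) = z from extChartAt_to_inv (I := 𝓡∂ 4) z] at h
    rw [hℓ0]
    exact h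
  have hγd : HasMFDerivAt 𝓘(ℝ, ℝ) (𝓡∂ 4) γ 0
      ((tangentCoordChange (𝓡∂ 4) z z z).comp (ContinuousLinearMap.toSpanSingleton ℝ v) :) := by
    have h := hsymm.comp (0 : ℝ) (hℓd.hasMFDerivWithinAt (s := univ)) fun s _ => hℓI s
    exact h.hasMFDerivAt univ_mem
  refine ⟨γ, hγ0, hγd.mdifferentiableAt, ?_, ?_⟩
  · rw [hγd.mfderiv]
    show tangentCoordChange (𝓡∂ 4) z z z (ContinuousLinearMap.toSpanSingleton ℝ v (1 : ℝ)) = v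
    rw [ContinuousLinearMap.toSpanSingleton_apply, one_smul]
    exact tangentCoordChange_self (mem_extChartAt_source z)
  · -- stays in `∂W` and in `U`
    have hγc : ContinuousAt γ 0 := hγd.continuousAt
    have hU' : ∀ᶠ s in 𝓝 (0 : ℝ), γ s ∈ U := hγc.preimage_mem_nhds (by rw [hγ0]; exact hU)
    filter_upwards [htgt, hU'] with s hs hsU
    refine ⟨?_, hsU⟩
    have hsrc : γ s ∈ (chartAt (EuclideanHalfSpace 4) z).source := by
      rw [← extChartAt_source (I := 𝓡∂ 4)]; exact c.map_target hs
    refine isBoundaryPoint_of_extend_apply_zero hsrc ?_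
    show (c (c.symm (ℓ s))) 0 = 0
    rw [c.right_inv hs]
    show (q₀ + s • v) 0 = 0
    rw [PiLp.add_apply, PiLp.smul_apply, hq₀0, hv, smul_zero, add_zero]

/-- **On vectors tangent to the boundary, the differential of the push is the differential of
the flow-out map at depth `κ`.**  For `z ∈ ∂W` in the domain of the box of a centre `y`, and `v`
tangent to `∂W`: `d(push)_z v = d(curve(·, κ))_z v`, `κ = Γ.pushDepth` — along a curve `γ ⊂ ∂W`
tangent to `v` the push *is* `Fl(·, κ) = curve(·, κ)` (`push_eq_Fl_of_mem_boundary`,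
`Fl_eq_of_mem_dom`), and derivatives of maps agreeing near `0` along `γ` agree.
[cite: MilnorHCobordism1965, proof of Thm. 3.4] -/
theorem mfderiv_push_apply_of_boundary {y : W} (hy : y ∈ Γ.T) {z : W} (hz : z ∈ (Γ.bx y hy).dom)
    (hzb : z ∈ (𝓡∂ 4).boundary W) {v : EuclideanSpace ℝ (Fin 4)} (hv : v 0 = 0) :
    mfderiv (𝓡∂ 4) (𝓡∂ 4) Γ.push z v =
      mfderiv (𝓡∂ 4) (𝓡∂ 4) (fun z' => (Γ.bx y hy).curve z' Γ.pushDepth) z v := by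
  have hκa : Γ.pushDepth ≤ Γ.a := by
    have h1 := Γ.pushDepth_le_pushLen
    have h2 := Γ.two_mul_pushLen
    have h3 := Γ.pushLen_pos
    linarith
  have hκε : Γ.pushDepth ∈ Icc 0 (Γ.bx y hy).box.ε :=
    ⟨Γ.pushDepth_pos.le, hκa.trans (Γ.a_le_ε y hy)⟩
  obtain ⟨γ, hγ0, hγd, hγv, hγev⟩ := exists_curve_in_boundary hzb hv ((Γ.bx y hy).isOpen_dom.mem_nhds hz)
  -- along `γ` the push is the flow-out at depth `κ`, i.e. the box curve
  have heq : (Γ.push ∘ γ) =ᶠ[𝓝 0] ((fun z' => (Γ.bx y hy).curve z' Γ.pushDepth) ∘ γ) := by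
    filter_upwards [hγev] with s hs
    obtain ⟨hsb, hsd⟩ := hs
    have hf0 : D.f (γ s) = 0 := (D.f_eq_zero_iff _).2 hsb
    show Γ.push (γ s) = (Γ.bx y hy).curve (γ s) Γ.pushDepth
    rw [Γ.push_eq_Fl_of_mem_boundary hsb, Γ.Fl_eq_of_mem_dom hy (by rw [hf0]; exact Γ.a_pos.le) hsd
      ⟨by rw [hf0, neg_zero]; exact Γ.pushDepth_pos.le, hκa⟩]
  have h1 := heq.mfderiv_eq (I := 𝓘(ℝ, ℝ)) (I' := 𝓡∂ 4)
  have hpush : MDifferentiableAt (𝓡∂ 4) (𝓡∂ 4) Γ.push (γ 0) :=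
    (Γ.contMDiff_push (γ 0)).mdifferentiableAt (by simp)
  have hcurve : MDifferentiableAt (𝓡∂ 4) (𝓡∂ 4) (fun z' => (Γ.bx y hy).curve z' Γ.pushDepth) (γ 0) := by
    rw [hγ0]; exact (Γ.bx y hy).mdifferentiableAt_curve hz hκε
  rw [mfderiv_comp 0 hpush hγd, mfderiv_comp 0 hcurve hγd, hγ0] at h1
  have h2 := DFunLike.congr_fun h1 (1 : ℝ)
  rw [← hγv]
  exact h2

end Literature.Topology.FourManifolds.FlowoutInput.Cover

namespace Literature.Geometry.Symplectic

open Literature.Geometry.Kaehler Literature.Topology.FourManifolds Literature.Analysis.ODE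

/-! ### The twisting loop of a framed Legendrian knot is continuous -/

namespace SteinStructure

section TwistingLoop

variable {W : Type*} [TopologicalSpace W] [ChartedSpace (EuclideanHalfSpace 4) W]
  [IsManifold (𝓡∂ 4) ∞ W] [CompactSpace W] [T2Space W]

/-- **The twisting loop of a framed smooth loop is continuous** (`ω` is a smooth 2-form, `α` is
continuous on `TW`, the velocity and the framing are continuous into `TW`). [folklore] -/
theorem continuous_twistingLoop (S : SteinStructure W) {K : (Metric.sphere (0 : EuclideanSpace ℝ (Fin 2)) 1) → W}
    (hK : ContMDiff (𝓡 1) (𝓡∂ 4) ∞ K) {ν : (Metric.sphere (0 : EuclideanSpace ℝ (Fin 2)) 1) → EuclideanSpace ℝ (Fin 4)}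
    (hν : IsKnotFraming K ν) : Continuous (S.twistingLoop K ν) := by
  rw [continuous_iff_continuousAt]
  intro t
  have hνc : ContinuousWithinAt (fun t : ℝ =>
      (TotalSpace.mk' (EuclideanSpace ℝ (Fin 4)) (K (circlePt t)) (ν (circlePt t)) : TangentBundle (𝓡∂ 4) W))
      univ t :=
    ((hν.continuous.comp continuous_circlePt).continuousAt).continuousWithinAt
  have hvel : ContinuousWithinAt (fun t : ℝ =>
      (TotalSpace.mk' (EuclideanSpace ℝ (Fin 4)) (K (circlePt t)) (knotVelocity K t) : TangentBundle (𝓡∂ 4) W))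
      univ t :=
    ((continuous_knotVelocity_bundle hK).continuousAt).continuousWithinAt
  have hx : ContinuousWithinAt (fun t : ℝ => K (circlePt t)) univ t :=
    ((hK.continuous.comp continuous_circlePt).continuousAt).continuousWithinAt
  have hω : ContinuousWithinAt (fun t : ℝ =>
      S.kahlerForm (K (circlePt t)) (knotVelocity K t) (ν (circlePt t))) univ t :=
    (S.isSmoothForm_kahler.continuousWithinAt_eval₂ hx hvel hνc).neg
  have hα : ContinuousWithinAt (fun t : ℝ => S.contactForm (K (circlePt t)) (ν (circlePt t))) univ t :=
    ContinuousWithinAt.contactForm_apply S hνc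
  have hform : S.twistingLoop K ν = fun t =>
      ((S.kahlerForm (K (circlePt t)) (knotVelocity K t) (ν (circlePt t)) : ℝ) : ℂ) +
        (S.contactForm (K (circlePt t)) (ν (circlePt t)) : ℂ) * Complex.I := by
    funext t
    rw [SteinStructure.twistingLoop_apply, Complex.mk_eq_add_mul_I]
  rw [hform, ← continuousWithinAt_univ]
  exact (Complex.continuous_ofReal.continuousAt.comp_continuousWithinAt hω).add
    ((Complex.continuous_ofReal.continuousAt.comp_continuousWithinAt hα).mul
      continuousWithinAt_const)

end TwistingLoop

/-! ### Gray transport of Legendrian attaching data to a lower level -/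

variable {W : Type*} [TopologicalSpace W] [T2Space W] [ChartedSpace (EuclideanHalfSpace 4) W]
  [IsManifold (𝓡∂ 4) ∞ W] [CompactSpace W]

/-- **Legendrian attaching data survive the shrinking of a Stein domain.**  Let `(W, S)` be a
compact Stein domain with `W ≠ ∅` (so `∂W ≠ ∅`).  There are a level `c < max φ` above the
critical values of `φ` (so that `W_c = {φ ≤ c}` carries the restricted Stein structure
`S.sublevel`, `SteinDomainSublevel.lean`) and a diffeomorphism `e : W ≅ W_c` such that for every
Legendrian knot `K` in `∂W` and every framing `ν` of `K`:  `e ∘ K` is a Legendrian knot in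
`∂W_c` for `S.sublevel`, `u ↦ de(ν u)` is a framing of it, and its twisting number equals that
of `ν`.  The diffeomorphism is the push of `W` into itself along the normalised Liouville flow
(`SteinLiouvilleField.lean`, `SteinDomainPush.lean`); on `∂W` it is the flow-out map, whose
differential maps `T∂W = ker dφ` to `T∂W_c` and the complex tangencies to the complex
tangencies, scaling the contact form by a positive factor (`SteinLevelTransport.lean`) — Gray
stability along the levels of `φ`.  Equality of the twisting numbers: the twisting loops of
`(K, ν)` and of `(e ∘ K, de ν)` are pointwise never antipodal (`not_antipodal_mfderiv_curve`),
so the straight-line homotopy between them avoids `0` and the winding number is constant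
(`wind_eq_of_homotopy`). [cite: CieliebakEliashberg2012, §2] [cite: Gompf1998, §1] -/
theorem exists_sublevel_transport [Nonempty W] (S : SteinStructure W) :
    ∃ (c : ℝ) (hc : c < sSup (range S.φ))
      (hreg : ∀ x, c ≤ S.φ x → mfderiv (𝓡∂ 4) 𝓘(ℝ, ℝ) S.φ x ≠ 0) (hne : ∃ x, S.φ x = c),
      letI := (S.subAtlas hc hreg).chartedSpace
      haveI := (S.subAtlas hc hreg).isManifold
      haveI := S.compactSpace_sublevel (c := c)
      ∃ e : W ≃ₘ⟮𝓡∂ 4, 𝓡∂ 4⟯ ↥(S.φ ⁻¹' Iic c),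
        ∀ (K : (Metric.sphere (0 : EuclideanSpace ℝ (Fin 2)) 1) → W)
          (ν : (Metric.sphere (0 : EuclideanSpace ℝ (Fin 2)) 1) → EuclideanSpace ℝ (Fin 4)),
          IsLegendrianKnot S.J K → IsKnotFraming K ν →
            IsLegendrianKnot (S.sublevel hc hreg hne).J (e ∘ K) ∧
            IsKnotFraming (e ∘ K) (fun u => mfderiv (𝓡∂ 4) (𝓡∂ 4) e (K u) (ν u)) ∧
            (S.sublevel hc hreg hne).twisting (e ∘ K) (fun u => mfderiv (𝓡∂ 4) (𝓡∂ 4) e (K u) (ν u)) =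
              S.twisting K ν := by
  -- the flow-out input of the normalised Liouville field and a cover of small depth
  obtain ⟨c₀, hc₀, hreg₀⟩ := S.exists_liouvilleFlowout_params
  set M := sSup (range S.φ) with hM
  set c₁ := (c₀ + M) / 2 with hc₁def
  have hc : c₀ < c₁ := by rw [hc₁def]; linarith
  have hc₁ : c₁ < M := by rw [hc₁def]; linarith
  set D := S.liouvilleFlowout hc hc₁ hreg₀ with hDdef
  obtain ⟨Γ, hΓ⟩ := exists_cover_pushDepth_le D (sub_pos.2 hc₁)
  set κ := Γ.pushDepth with hκ
  have hκpos : 0 < κ := Γ.pushDepth_pos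
  -- the level `c = M - κ`
  have hcM : M - κ < M := by linarith
  have hregc : ∀ x, M - κ ≤ S.φ x → mfderiv (𝓡∂ 4) 𝓘(ℝ, ℝ) S.φ x ≠ 0 := fun x hx =>
    hreg₀ x (by linarith)
  obtain ⟨x₀, hx₀⟩ := S.exists_isBoundaryPoint
  have hne : ∃ x, S.φ x = M - κ := S.exists_φ_eq_of_boundary_nonempty hcM hregc ⟨x₀, hx₀⟩
  refine ⟨M - κ, hcM, hregc, hne, ?_⟩
  letI := (S.subAtlas hcM hregc).chartedSpace
  haveI := (S.subAtlas hcM hregc).isManifold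
  haveI := S.compactSpace_sublevel (c := M - κ)
  obtain ⟨e, he, heb⟩ := S.exists_diffeomorph_sublevel_eq_push (D := D) (fun z => rfl) Γ hcM hregc
  refine ⟨e, fun K ν hK hν => ?_⟩
  -- notation and basic facts
  set S' := S.sublevel hcM hregc hne with hS'
  have hKb : IsBoundaryKnot K := hK.isBoundaryKnot
  have hK'b : IsBoundaryKnot (e ∘ K) := hKb.comp_diffeomorph' e
  have hν' : IsKnotFraming (e ∘ K) fun u => mfderiv (𝓡∂ 4) (𝓡∂ 4) e (K u) (ν u) :=
    hν.pushforward' hKb e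
  have hKd : MDifferentiable (𝓡 1) (𝓡∂ 4) K := fun u =>
    (hK.isSmoothEmbedding.contMDiff u).mdifferentiableAt (by simp)
  have hed : MDifferentiable (𝓡∂ 4) (𝓡∂ 4) e := fun x => (e.contMDiff x).mdifferentiableAt (by simp)
  have hK'd : MDifferentiable (𝓡 1) (𝓡∂ 4) (e ∘ K) := fun u => (hed _).comp u (hKd u)
  have hval : ∀ p, MDifferentiableAt (𝓡∂ 4) (𝓡∂ 4) (Subtype.val : ↥(S.φ ⁻¹' Iic (M - κ)) → W) p :=
    fun p => (RegularDomain.contMDiff_val (S.subAtlas hcM hregc) rfl p).mdifferentiableAt (by simp)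
  have hvale : (Subtype.val ∘ e : W → W) = Γ.push := funext he
  have hpushd : MDifferentiable (𝓡∂ 4) (𝓡∂ 4) Γ.push := fun x =>
    (Γ.contMDiff_push x).mdifferentiableAt (by simp)
  -- `Dι ∘ de = d(push)`
  have hDe : ∀ (z : W) (w : EuclideanSpace ℝ (Fin 4)),
      RegularDomain.valDeriv (S.subAtlas hcM hregc) rfl (e z) (mfderiv (𝓡∂ 4) (𝓡∂ 4) e z w) =
        mfderiv (𝓡∂ 4) (𝓡∂ 4) Γ.push z w := fun z w => by
    rw [RegularDomain.valDeriv_apply, ← hvale, mfderiv_comp z (hval _) (hed z)]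
    rfl
  -- the box of a boundary point and the transport identities there
  have hbox : ∀ {z : W} (hz : z ∈ (𝓡∂ 4).boundary W),
      ∃ (y : W) (hy : y ∈ Γ.T), z ∈ (Γ.bx y hy).dom := fun {z} hz => by
    have hf0 : D.f z = 0 := (D.f_eq_zero_iff z).2 hz
    exact Γ.cover z (by rw [hf0]; exact Γ.a_pos.le)
  have hκa : κ ≤ Γ.a := by
    have h1 := Γ.pushDepth_le_pushLen
    have h2 := Γ.two_mul_pushLen
    have h3 := Γ.pushLen_pos
    rw [hκ]; linarith
  have key : ∀ {z : W} (hz : z ∈ (𝓡∂ 4).boundary W),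
      ∃ (y : W) (hy : y ∈ Γ.T) (_ : z ∈ (Γ.bx y hy).dom),
        Γ.push z = (Γ.bx y hy).curve z κ ∧ κ ∈ Icc 0 (Γ.bx y hy).box.ε := fun {z} hz => by
    obtain ⟨y, hy, hzd⟩ := hbox hz
    have hf0 : D.f z = 0 := (D.f_eq_zero_iff z).2 hz
    refine ⟨y, hy, hzd, ?_, Γ.pushDepth_pos.le, hκa.trans (Γ.a_le_ε y hy)⟩
    rw [Γ.push_eq_Fl_of_mem_boundary hz, Γ.Fl_eq_of_mem_dom hy (by rw [hf0]; exact Γ.a_pos.le) hzd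
      ⟨by rw [hf0, neg_zero]; exact Γ.pushDepth_pos.le, hκa⟩]
  -- (1) Legendrian
  have hLeg' : IsLegendrianKnot S'.J (e ∘ K) := by
    refine ⟨hK'b.isSmoothEmbedding, hK'b.isBoundaryPoint, fun u w => ?_⟩
    have hzb : K u ∈ (𝓡∂ 4).boundary W := hK.isBoundaryPoint u
    obtain ⟨y, hy, hzd, hpush, hκε⟩ := key hzb
    have hw0 := (hK.mfderiv_mem u w).1
    refine (S.sublevel_mem_contactPlane_iff hcM hregc hne (hK'b.isBoundaryPoint u) _).2 ?_
    -- `Dι (d(e ∘ K) w) = d(push)(dK w) = d(curve_κ)(dK w)`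
    have hchain : RegularDomain.valDeriv (S.subAtlas hcM hregc) rfl ((e ∘ K) u)
        (mfderiv (𝓡 1) (𝓡∂ 4) (e ∘ K) u w) =
        mfderiv (𝓡∂ 4) (𝓡∂ 4) (fun z' => (Γ.bx y hy).curve z' κ) (K u)
          (mfderiv (𝓡 1) (𝓡∂ 4) K u w) := by
      rw [show (e ∘ K) u = e (K u) from rfl, mfderiv_comp u (hed _) (hKd u),
        ContinuousLinearMap.comp_apply, hDe, Γ.mfderiv_push_apply_of_boundary hy hzd hzb hw0]
    have hpt : ((e ∘ K) u : W) = (Γ.bx y hy).curve (K u) κ := by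
      show (e (K u) : W) = _; rw [he, hpush]
    rw [hchain, hpt]
    refine ⟨?_, ?_⟩
    · rw [S.dφ_mfderiv_curve rfl (C := Γ.bx y hy) hzd hκε]
      exact S.mfderiv_φ_apply_eq_zero hzb hw0
    · obtain ⟨m, -, hm⟩ := S.exists_pos_contactForm_mfderiv_curve rfl (C := Γ.bx y hy) hzd hκε
      rw [hm, S.contactForm_apply_eq_zero hzb (hK.mfderiv_mem u w), mul_zero]
  refine ⟨hLeg', hν', ?_⟩
  -- (2) twisting: the straight-line homotopy between the twisting loops is zero-free
  set ℓ₀ := S.twistingLoop K ν with hℓ₀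
  set ℓ₁ := S'.twistingLoop (e ∘ K) (fun u => mfderiv (𝓡∂ 4) (𝓡∂ 4) e (K u) (ν u)) with hℓ₁
  have hℓ₀c : Continuous ℓ₀ := S.continuous_twistingLoop hK.isSmoothEmbedding.contMDiff hν
  have hℓ₁c : Continuous ℓ₁ := S'.continuous_twistingLoop hK'b.isSmoothEmbedding.contMDiff hν'
  have hℓ₀ne : ∀ t, ℓ₀ t ≠ 0 := fun t => hν.twistingLoop_ne_zero hK t
  have hℓ₁ne : ∀ t, ℓ₁ t ≠ 0 := fun t => hν'.twistingLoop_ne_zero hLeg' t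
  -- the key pointwise relation: `ℓ₁ t` is never a negative multiple of `ℓ₀ t`
  have hanti : ∀ (t : ℝ) (μ : ℝ), 0 < μ → ℓ₁ t = -(μ : ℂ) * ℓ₀ t → False := by
    intro t μ hμ hrel
    have hzb : K (circlePt t) ∈ (𝓡∂ 4).boundary W := hK.isBoundaryPoint _
    obtain ⟨y, hy, hzd, hpush, hκε⟩ := key hzb
    -- ambient expressions of the transported velocity and framing
    have hvel0 := (hK.knotVelocity_mem t).1
    have hνt0 := (mem_boundaryTangentSpace_iff _).1 (hν.mem_boundaryTangentSpace (circlePt t))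
    have hvel' : RegularDomain.valDeriv (S.subAtlas hcM hregc) rfl ((e ∘ K) (circlePt t))
        (knotVelocity (e ∘ K) t) =
        mfderiv (𝓡∂ 4) (𝓡∂ 4) (fun z' => (Γ.bx y hy).curve z' κ) (K (circlePt t)) (knotVelocity K t) := by
      rw [S.valDeriv_knotVelocity hcM hregc hK'd, show Subtype.val ∘ e ∘ K = Γ.push ∘ K from by
        rw [← hvale]; rfl, knotVelocity_comp' hpushd hKd,
        Γ.mfderiv_push_apply_of_boundary hy hzd hzb hvel0]
    have hfr' : RegularDomain.valDeriv (S.subAtlas hcM hregc) rfl ((e ∘ K) (circlePt t))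
        (mfderiv (𝓡∂ 4) (𝓡∂ 4) e (K (circlePt t)) (ν (circlePt t))) =
        mfderiv (𝓡∂ 4) (𝓡∂ 4) (fun z' => (Γ.bx y hy).curve z' κ) (K (circlePt t)) (ν (circlePt t)) := by
      rw [show (e ∘ K) (circlePt t) = e (K (circlePt t)) from rfl, hDe,
        Γ.mfderiv_push_apply_of_boundary hy hzd hzb hνt0]
    have hpt : ((e ∘ K) (circlePt t) : W) = (Γ.bx y hy).curve (K (circlePt t)) κ := by
      show (e (K (circlePt t)) : W) = _; rw [he, hpush]
    -- the two loops at `t`, componentwise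
    have h1 : ℓ₁ t = ⟨S.kahlerForm ((Γ.bx y hy).curve (K (circlePt t)) κ)
        (mfderiv (𝓡∂ 4) (𝓡∂ 4) (fun z' => (Γ.bx y hy).curve z' κ) (K (circlePt t)) (knotVelocity K t))
        (mfderiv (𝓡∂ 4) (𝓡∂ 4) (fun z' => (Γ.bx y hy).curve z' κ) (K (circlePt t)) (ν (circlePt t))),
        S.contactForm ((Γ.bx y hy).curve (K (circlePt t)) κ)
          (mfderiv (𝓡∂ 4) (𝓡∂ 4) (fun z' => (Γ.bx y hy).curve z' κ) (K (circlePt t)) (ν (circlePt t)))⟩ := by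
      rw [hℓ₁, S.sublevel_twistingLoop hcM hregc hne, hvel', hfr', hpt]
    have h0 : ℓ₀ t = ⟨S.kahlerForm (K (circlePt t)) (knotVelocity K t) (ν (circlePt t)),
        S.contactForm (K (circlePt t)) (ν (circlePt t))⟩ := rfl
    rw [h1, h0] at hrel
    have hre := congrArg Complex.re hrel
    have him := congrArg Complex.im hrel
    simp only [Complex.mul_re, Complex.mul_im, Complex.neg_re, Complex.neg_im, Complex.ofReal_re,
      Complex.ofReal_im, neg_zero, zero_mul, sub_zero, add_zero] at hre him
    have hα0 : S.contactForm (K (circlePt t)) (knotVelocity K t) = 0 :=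
      S.contactForm_apply_eq_zero hzb (hK.knotVelocity_mem t)
    obtain ⟨hG0, hH0⟩ := S.not_antipodal_mfderiv_curve rfl (C := Γ.bx y hy) hzd hκε hα0 hμ
      (by linarith [hre]) (by linarith [him])
    exact hℓ₀ne t (by rw [h0, hG0, hH0]; rfl)
  -- the homotopy
  set H : ℝ → ℝ → ℂ := fun s t => (1 - (s : ℂ)) * ℓ₀ t + (s : ℂ) * ℓ₁ t with hH
  have hHc : ContinuousOn (fun p : ℝ × ℝ => H p.1 p.2) (Icc 0 1 ×ˢ Icc 0 1) := by
    apply Continuous.continuousOn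
    simp only [hH]
    fun_prop
  have hHne : ∀ s ∈ Icc (0 : ℝ) 1, ∀ t ∈ Icc (0 : ℝ) 1, H s t ≠ 0 := by
    intro s hs t _ h0
    simp only [hH] at h0
    rcases eq_or_lt_of_le hs.1 with hs0 | hs0
    · subst hs0
      simp at h0
      exact hℓ₀ne t h0
    rcases eq_or_lt_of_le hs.2 with hs1 | hs1
    · subst hs1
      simp at h0
      exact hℓ₁ne t h0
    -- `0 < s < 1`: `ℓ₁ t = -((1 - s)/s) ℓ₀ t`
    have hsne : (s : ℂ) ≠ 0 := by exact_mod_cast hs0.ne'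
    have hmul : (s : ℂ) * ℓ₁ t = -((1 - (s : ℂ)) * ℓ₀ t) := eq_neg_of_add_eq_zero_right h0
    have hrel : ℓ₁ t = -((1 - (s : ℂ)) / (s : ℂ)) * ℓ₀ t := by
      field_simp
      linear_combination hmul
    refine hanti t ((1 - s) / s) (div_pos (by linarith) hs0) ?_
    rw [hrel]
    push_cast
    ring
  have hHloop : ∀ s ∈ Icc (0 : ℝ) 1, H s 0 = H s 1 := by
    intro s _
    simp only [hH]
    have h0' := S.twistingLoop_add_one hKd ν 0
    have h1' := S'.twistingLoop_add_one hK'd (fun u => mfderiv (𝓡∂ 4) (𝓡∂ 4) e (K u) (ν u)) 0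
    rw [zero_add] at h0' h1'
    rw [hℓ₀, hℓ₁, h0', h1']
  have hw := Literature.Probability.RandomPlanarGeometry.wind_eq_of_homotopy H hHc hHne hHloop
  have hH0 : H 0 = ℓ₀ := by funext t; simp [hH]
  have hH1 : H 1 = ℓ₁ := by funext t; simp [hH]
  rw [hH0, hH1] at hw
  show Literature.Topology.PlaneTopology.wind ℓ₁ = Literature.Topology.PlaneTopology.wind ℓ₀
  exact hw.symm

end SteinStructure

/-! ### E2 reduces to E2 for shrunk Stein domains -/

/-- **Eliashberg's theorem E2 follows from its case of shrunk Stein domains.**  Suppose that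
for every compact Stein `(W, S)`, every level `c < max φ` above the critical values of `φ`
(with `{φ = c} ≠ ∅`) and every finite family of 2-handles attached to the Stein sublevel domain
`W_c = {φ ≤ c}` (restricted structure `S.sublevel`, `SteinDomainSublevel.lean`) along Legendrian
knots of twisting `-1`, the attachment is a Stein domain.  Then `Gompf1998_thm13_twoHandles`
holds: given 2-handles attached to `W` itself along Legendrian knots of twisting `-1` in
`∂W = {φ = max φ}`, transport the attaching maps along the diffeomorphism `e : W ≅ W_c` of
`SteinStructure.exists_sublevel_transport` (`HandleAttachingMap.IsMultiAttachment.transport`);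
the transported attaching circles `e ∘ Kᵢ` are Legendrian in `∂W_c` with the transported
handle framings `de(νᵢ)` (`attachingFraming_transport`) of the same twisting `-1`.  (For `W = ∅`
there are no handles and `P ≅ W`.)  The point of the reduction: `W_c` lies in the *interior* of
`W`, an honest open complex surface around the attaching circles, which is the setting of the
printed proofs (Eliashberg 1990, §2; Cieliebak–Eliashberg 2012, Ch. 8: handles are attached to
regular sublevel sets `{φ ≤ c}` of `J`-convex functions on Stein surfaces).
[cite: Gompf1998, Thm. 1.3] [cite: CieliebakEliashberg2012, Def. 1.1 ff.] -/
theorem Gompf1998_thm13_twoHandles_of_sublevel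
    (H : ∀ (W : Type) [TopologicalSpace W] [T2Space W] [ChartedSpace (EuclideanHalfSpace 4) W]
      [IsManifold (𝓡∂ 4) ∞ W] [CompactSpace W] (S : SteinStructure W) (c : ℝ)
      (hc : c < sSup (range S.φ)) (hreg : ∀ x, c ≤ S.φ x → mfderiv (𝓡∂ 4) 𝓘(ℝ, ℝ) S.φ x ≠ 0)
      (hne : ∃ x, S.φ x = c)
      (P : Type) [TopologicalSpace P] [ChartedSpace (EuclideanHalfSpace 4) P] [IsManifold (𝓡∂ 4) ∞ P]
      [CompactSpace P] (ι : Type) [Finite ι],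
      letI := (S.subAtlas hc hreg).chartedSpace
      haveI := (S.subAtlas hc hreg).isManifold
      haveI := S.compactSpace_sublevel (c := c)
      ∀ h : ι → HandleAttachingMap 3 2 ↥(S.φ ⁻¹' Iic c),
        HandleAttachingMap.IsMultiAttachment h (𝓡∂ 4) P →
        (∀ i, IsLegendrianKnot (S.sublevel hc hreg hne).J (h i).attachingCircle) →
        (∀ i, (S.sublevel hc hreg hne).twisting (h i).attachingCircle (h i).attachingFraming = -1) →
        IsSteinDomain P) :
    Gompf1998_thm13_twoHandles := by
  intro W P _ _ _ _ _ _ _ _ _ S ι _ h hP hLeg htw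
  rcases isEmpty_or_nonempty W with hW | hW
  · -- no points, hence no handles
    haveI : IsEmpty ι := ⟨fun i => hW.elim ((h i).toFun (coreTubePt (circlePt 0)))⟩
    exact isSteinDomain_of_isMultiAttachment_of_isEmpty S hP
  · obtain ⟨c, hc, hreg, hne, e, he⟩ := S.exists_sublevel_transport
    letI := (S.subAtlas hc hreg).chartedSpace
    haveI := (S.subAtlas hc hreg).isManifold
    haveI := S.compactSpace_sublevel (c := c)
    have hP' := hP.transport e
    refine H W S c hc hreg hne P ι (fun i => (h i).transport e) hP' (fun i => ?_) fun i => ?_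
    · rw [HandleAttachingMap.attachingCircle_transport]
      exact (he _ _ (hLeg i) (isKnotFraming_attachingFraming (h i))).1
    · have hfr : ((h i).transport e).attachingFraming = fun θ =>
          mfderiv (𝓡∂ 4) (𝓡∂ 4) e ((h i).attachingCircle θ) ((h i).attachingFraming θ) :=
        funext fun θ => HandleAttachingMap.attachingFraming_transport (h i) e θ
      rw [HandleAttachingMap.attachingCircle_transport, hfr,
        (he _ _ (hLeg i) (isKnotFraming_attachingFraming (h i))).2.2]
      exact htw i

end Literature.Geometry.Symplectic

end
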